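import Summits.QuantumAdvantage.QuantumAdvantage.Theorems.SosSandwichTransferPBNodeThresholds
import Summits.QuantumAdvantage.QuantumAdvantage.Theorems.SosSandwichTransferPBTruncatedRunsBlock
import Literature.Computability.QuantumComplexity.KeyedTruncBlocksUniform
import HarnessLib

/-!
# Crux `TransferPB` (stmt-QuantumAdvantage-15238, route SosSandwich), line `birth` — the node-test BLOCK STATISTIC and the uniform estimator

Obligation (Q) of stub `stub_pbOracleSimulation` (`nodeProblem F r c k ∈ PromiseBQP`). The joint estimator is the truncated-runs
keyed blocks run `truncRun F nOfLayout` (`Theorems/…TruncatedRuns.lean`) on the layout with copies `layoutC F v`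
(`Theorems/…LayoutCopies.lean`); the read-out layer (`PolyBlockStatReadout.mem_PromiseBQP_of_blockStat_thresholds_pre`) applies a
polynomial-time STRING STATISTIC to `⟨z, s⟩` (`s` the measured output string) and thresholds the mean number of ones. This file:

* **`truncRun_family_isUniform`** — the estimator family is polynomial-time uniform for uniform `F`
  (`KeyedBlocks.trunc_family_isUniform` with `codeFP_oracleQueries_un`, `codeFP_nOfLayout`, `codeFP_keyWidth`);
* `oracleRawAt`, `filter_toRaw_eq_map_oraclePositions` — the `b`-th raw ORACLE gate of a raw gate list is the code of the
  `b`-th oracle gate recorded by `oraclePositions`; `queryStr F z s b` — the query register of block `b` read off `s` through the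
  block wires (`KeyedBlocks.embB`), `queryStr_eq_queryOf`;
* `meanBit`, `targetTest`, **`nodeStat F z s`** — the statistic: on MEAN layouts the answer wire of the full block, otherwise one
  bit per oracle gate `b < T(n)`: "the query register of block `b` passes the target test of the tag field" (`= σ` for SINGLE
  `01σ`; `u ⊑ ·` and short for BLOCK `00u`); `nodeM` (its length); the EVENT identities `setOf_nodeStat_mean`,
  `nodeStat_getD_query`, `setOf_targetTest_single`, `setOf_targetTest_block` matching the kernel identities of
  `Theorems/…TruncatedRuns{,Block}.lean` literally.

The `FP` computation of `nodeStat` on codes is the sequel file. All proved; definitions are explicit string functions.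
Sources: C. H. Bennett, E. Bernstein, G. Brassard, U. Vazirani, SIAM J. Comput. 26 (1997), Def. 3.2 / Cor. 3.4 (proof), Thm. 4.14;
M. Zhandry, CRYPTO 2012, Thm. 3.1; S. Aaronson, A. Ambainis, Theory Comput. 10 (2014), proof of Thm. 23 (p. 14).
-/

-- D-0017: single-conjunct summit ⇒ the duplicate `QuantumAdvantage.QuantumAdvantage` is mandated.
set_option linter.dupNamespace false

noncomputable section

namespace Summit.QuantumAdvantage.QuantumAdvantage.Cruxes.TransferPB.Birth

open Finset Literature.Computability.Cryptography Literature.Computability.Complexity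
  Literature.Computability.Complexity.Brick Literature.Computability.Complexity.Plumb
  Literature.Computability.QuantumComplexity Literature.Computability.QuantumComplexity.ClassicalSimulation
  Literature.Computability.Cryptography.ExplicitKWiseHash
open _root_.Computability CodeFP Polynomial

namespace SimTreePB

variable (F : QCircuitFamily cliffordT)

/-! ### The estimator family is uniform -/

variable {F} in
/-- **The truncated-runs estimator of the node tests is a polynomial-time uniform family**, for a uniform `F` and an
input-length function computed on unary codes. [cite: BennettBernsteinBrassardVazirani1997, Thm. 4.14] [cite: Zhandry2012IBE, Thm. 3.1] -/
theorem truncRun_family_isUniform (hF : F.IsUniform) {nOf : ℕ → ℕ} (hn : CodeFP unE unE nOf) :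
    (truncRun F nOf).family.IsUniform :=
  KeyedBlocks.trunc_family_isUniform F nOf _ hF (codeFP_oracleQueries_un F hF) hn
    ((codeFP_keyWidth F hF).comp (KeyedBlocks.codeFP_truncNOf F nOf (codeFP_oracleQueries_un F hF) hn))

/-! ### The raw oracle gates -/

/-- **The `b`-th raw ORACLE gate of a raw gate list** (default `(0, 0, [])` past the end). [cite: AroraBarak2009, §6.1] -/
def oracleRawAt (rg : List RawGate) (b : ℕ) : RawGate := (rg.filter fun γ => γ.1).getD b (false, 0, [])

/-- **The raw oracle gates are the codes of the oracle gates recorded by `oraclePositions`**, in order.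
[cite: BennettBernsteinBrassardVazirani1997, Def. 3.2 (the i-th query)] -/
theorem filter_toRaw_eq_map_oraclePositions {G : QGateSet} [Encodable G.Op] {N : ℕ} : ∀ gs : List (QGate G N),
    (gs.map QGate.toRaw).filter (fun γ => γ.1) =
      (oraclePositions gs).map fun q => ((true, q.2.1, List.ofFn fun i : Fin (q.2.1 + 1) => ((q.2.2 i : Fin N) : ℕ)) : RawGate)
  | [] => rfl
  | (.gate g e) :: gs => by
    rw [List.map_cons, List.filter_cons_of_neg (by simp [QGate.toRaw]), filter_toRaw_eq_map_oraclePositions gs,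
      oraclePositions, List.map_map]
    rfl
  | (.oracle k e) :: gs => by
    rw [List.map_cons, List.filter_cons_of_pos (by simp [QGate.toRaw]), filter_toRaw_eq_map_oraclePositions gs,
      oraclePositions, List.map_cons, List.map_map]
    rfl

/-- The `b`-th raw oracle gate of `F.circ n`, for `b < T(n)`. [cite: BennettBernsteinBrassardVazirani1997, Def. 3.2] -/
theorem oracleRawAt_rawDesc (n b : ℕ) (hb : b < (oraclePositions (F.circ n).gates).length) :
    oracleRawAt (F.rawDesc n).2.2 b =
      (true, ((oraclePositions (F.circ n).gates)[b]).2.1,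
        List.ofFn fun i : Fin (((oraclePositions (F.circ n).gates)[b]).2.1 + 1) =>
          ((((oraclePositions (F.circ n).gates)[b]).2.2 i : Fin (n + F.ancillas n)) : ℕ)) := by
  unfold oracleRawAt
  rw [show (F.rawDesc n).2.2 = (F.circ n).gates.map QGate.toRaw from rfl, filter_toRaw_eq_map_oraclePositions,
    List.getD_eq_getElem _ _ (by rw [List.length_map]; exact hb), List.getElem_map]

/-! ### The query register of a block read off the output string -/

/-- The clipped block input length on instances of length `L`. -/
abbrev nP (L : ℕ) : ℕ := KeyedBlocks.truncNOf F nOfLayout L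

/-- **The query register of block `b` read off the output string `s`** (instance `z`): the query wires of the `b`-th raw
oracle gate of `F.circ n` (`n = nP |z|`), moved to block `b` (`KeyedBlocks.embB n |z| anc(n) b`), read in `s`.
[cite: BennettBernsteinBrassardVazirani1997, Cor. 3.4 (proof: measure the query tape)] -/
def queryStr (z s : List Bool) (b : ℕ) : List Bool :=
  (((oracleRawAt (F.rawDesc (nP F z.length)).2.2 b).2.2.take (oracleRawAt (F.rawDesc (nP F z.length)).2.2 b).2.1).map
    fun j => s.getD (KeyedBlocks.embB (nP F z.length) z.length (F.ancillas (nP F z.length)) b j) false)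

/-- The first `k` values of a function on `Fin (k + 1)`. [folklore] -/
private theorem take_ofFn_castSucc {α : Type} (k : ℕ) (f : Fin (k + 1) → α) :
    (List.ofFn f).take k = List.ofFn fun i : Fin k => f i.castSucc := by
  rw [List.ofFn_succ', List.concat_eq_append, List.take_append_of_le_length (by simp), List.take_of_length_le (by simp)]

/-- **`queryStr` is the query string of the `b`-th oracle gate read through the block wires `E b`.**
[cite: BennettBernsteinBrassardVazirani1997, Def. 3.2] -/
theorem queryStr_eq_queryOf (z s : List Bool)
    (b : Fin (oraclePositions (F.circ ((truncRun F nOfLayout).nOf z.length)).gates).length) :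
    queryStr F z s b =
      queryOf ((oraclePositions (F.circ ((truncRun F nOfLayout).nOf z.length)).gates)[(b : ℕ)]).2.2
        (fun i => s.getD (((truncRun F nOfLayout).E z.length
          ⟨b, by rw [KeyedBlocks.trunc_MOf, ← length_oraclePositions]; exact Nat.lt_succ_of_lt b.2⟩ i :
            Fin (z.length + (truncRun F nOfLayout).anc z.length)) : ℕ) false) := by
  unfold queryStr queryOf
  have hn : (truncRun F nOfLayout).nOf z.length = nP F z.length := rfl
  rw [oracleRawAt_rawDesc F (nP F z.length) b b.2]
  dsimp only
  rw [take_ofFn_castSucc, List.map_ofFn]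
  refine List.ofFn_inj.2 (funext fun i => ?_)
  simp only [Function.comp_apply, KeyedBlocks.embB]
  rfl

/-! ### The statistic -/

/-- **The MEAN bit**: the answer wire of the full block `T(n)` reads `1` (and there is one: `0 < n + anc(n)`).
[cite: AaronsonAmbainis2014, Thm. 23 (proof, p. 14)] -/
def meanBit (z s : List Bool) : Bool :=
  decide (0 < nP F z.length + F.ancillas (nP F z.length)) &&
    s.getD (KeyedBlocks.embB (nP F z.length) z.length (F.ancillas (nP F z.length))
      (F.circ (nP F z.length)).oracleQueries 0) false

/-- **The target test of the tag field** `t` on a query string `q`: SINGLE (`t = 01σ`): `q = σ`; BLOCK (`t = 00u`): `u ⊑ q`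
and `q` is short (`|q| < n + anc(n)`, i.e. `q` names a relevant bit). [cite: AaronsonAmbainis2014, Thm. 23 (proof, p. 14)] -/
def targetTest (z q : List Bool) : Bool :=
  if (tagOfC F z).getD 1 false then decide (q = (tagOfC F z).drop 2)
  else decide ((tagOfC F z).drop 2 <+: q) && decide (q.length < nP F z.length + F.ancillas (nP F z.length))

/-- **The node-test statistic** read off the output string `s` on the instance `z`: on MEAN layouts the MEAN bit, otherwise
one bit per oracle gate `b < T(n)` — the query register of block `b` passes the target test.
[cite: BennettBernsteinBrassardVazirani1997, Cor. 3.4 (proof)] [cite: AaronsonAmbainis2014, Thm. 23 (proof, p. 14)] -/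
def nodeStat (z s : List Bool) : List Bool :=
  if isMeanC F z then [meanBit F z s]
  else (List.range (F.circ (nP F z.length)).oracleQueries).map fun b => targetTest F z (queryStr F z s b)

/-- The number of bits of the statistic: `1` on MEAN layouts, `T(n)` otherwise. [cite: AaronsonAmbainis2014, Thm. 23 (proof, p. 14)] -/
def nodeM (z : List Bool) : ℕ := if isMeanC F z then 1 else (F.circ (nP F z.length)).oracleQueries

/-- The statistic has `nodeM` bits. [folklore] -/
theorem length_nodeStat (z s : List Bool) : (nodeStat F z s).length = nodeM F z := by
  unfold nodeStat nodeM
  split_ifs <;> simp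

/-! ### Event identities -/

/-- `[1] ⊑ ofFn f ↔ 0 < n ∧ f 0 = 1`. [folklore] -/
private theorem true_prefix_ofFn_iff {n : ℕ} (f : Fin n → Bool) :
    [true] <+: List.ofFn f ↔ ∃ h : 0 < n, f ⟨0, h⟩ = true := by
  cases n with
  | zero => simp
  | succ n => rw [List.ofFn_succ]; simp

/-- **On MEAN layouts, bit `0` of the statistic is the answer event of the full block** (the event of
`kernelProb_truncRun_full_eq_nodeMean`). [cite: AaronsonAmbainis2014, Thm. 23 (proof, p. 14)] -/
theorem setOf_nodeStat_mean (z : List Bool) (hz : isMeanC F z = true) :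
    {s : List Bool | (nodeStat F z s).getD 0 false = true} =
      {s | [true] <+: List.ofFn (fun i : Fin ((truncRun F nOfLayout).nOf z.length + F.ancillas ((truncRun F nOfLayout).nOf z.length)) =>
        s.getD (((truncRun F nOfLayout).E z.length
          ⟨(F.circ ((truncRun F nOfLayout).nOf z.length)).oracleQueries, by rw [KeyedBlocks.trunc_MOf]; exact Nat.lt_succ_self _⟩ i :
            Fin (z.length + (truncRun F nOfLayout).anc z.length)) : ℕ) false)} := by
  ext s
  simp only [Set.mem_setOf_eq, nodeStat, hz, ↓reduceIte, List.getD_cons_zero, true_prefix_ofFn_iff, meanBit,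
    Bool.and_eq_true, decide_eq_true_eq]
  have hn : (truncRun F nOfLayout).nOf z.length = nP F z.length := rfl
  constructor
  · rintro ⟨h0, h1⟩
    refine ⟨h0, ?_⟩
    rw [← h1, KeyedBlocks.E_val, KeyedBlocks.embB]
  · rintro ⟨h0, h1⟩
    refine ⟨h0, ?_⟩
    rw [← h1, KeyedBlocks.E_val, KeyedBlocks.embB]

/-- **On non-MEAN layouts, bit `b < T(n)` of the statistic is the target test of the query register of block `b`.**
[cite: BennettBernsteinBrassardVazirani1997, Cor. 3.4 (proof)] -/
theorem nodeStat_getD_query (z s : List Bool) (hz : isMeanC F z = false)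
    (b : Fin (oraclePositions (F.circ ((truncRun F nOfLayout).nOf z.length)).gates).length) :
    (nodeStat F z s).getD b false =
      targetTest F z (queryOf ((oraclePositions (F.circ ((truncRun F nOfLayout).nOf z.length)).gates)[(b : ℕ)]).2.2
        (fun i => s.getD (((truncRun F nOfLayout).E z.length
          ⟨b, by rw [KeyedBlocks.trunc_MOf, ← length_oraclePositions]; exact Nat.lt_succ_of_lt b.2⟩ i :
            Fin (z.length + (truncRun F nOfLayout).anc z.length)) : ℕ) false)) := by
  rw [← queryStr_eq_queryOf, nodeStat, hz]
  simp only [Bool.false_eq_true, ↓reduceIte]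
  have hb : (b : ℕ) < (F.circ (nP F z.length)).oracleQueries := lt_of_lt_of_eq b.2 (length_oraclePositions _)
  rw [List.getD_eq_getElem _ _ (by rw [List.length_map, List.length_range]; exact hb), List.getElem_map, List.getElem_range]

/-- Positions past the statistic read `0`: the event is empty. [folklore] -/
theorem setOf_nodeStat_of_le (z : List Bool) (i : ℕ) (hi : nodeM F z ≤ i) :
    {s : List Bool | (nodeStat F z s).getD i false = true} = ∅ := by
  ext s
  simp only [Set.mem_setOf_eq, Set.mem_empty_iff_false, iff_false]
  rw [List.getD_eq_default _ _ (by rw [length_nodeStat]; exact hi)]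
  exact Bool.false_ne_true

variable (x : List Bool) (ρ : List (Fin (numOracleBits F x) × Bool))

/-- The string of the bit named by a short string. [folklore] -/
private theorem bitString_bitEquiv' {u : List Bool} (h : u.length < oracleWidth F x) :
    bitString F x (bitEquiv F x ⟨u, mem_shortStrings.2 h⟩) = u := by
  unfold bitString
  rw [Equiv.symm_apply_apply]

/-- On a SINGLE layout the clipped input length is `|x|`. [folklore] -/
theorem nP_layoutC (w : List Bool) : nP F (layoutC F (boolPair x w)).length = x.length := truncRun_nOf_layoutC F x w

/-- **On a SINGLE layout the target test is `q = σ(s)`**: the event "query register `∈ {σ(s)}`" of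
`sum_kernelProb_truncRun_query_eq_bbbvMag`. [cite: AaronsonAmbainis2014, Thm. 23 (proof, p. 14)] -/
theorem targetTest_layoutC_encSingle (s : Fin (numOracleBits F x)) (q : List Bool) :
    targetTest F (layoutC F (encSingle F x ρ s)) q = decide (q ∈ ({bitString F x s} : Set (List Bool))) := by
  have ht : tagOfC F (layoutC F (encSingle F x ρ s)) = false :: true :: bitString F x s := tagOfC_layoutC F x _ _
  rw [targetTest, ht]
  simp

open scoped Classical in
/-- **On a BLOCK layout the target test is `u ⊑ q ∧ q short`**, i.e. the event "query register `∈ {σ(s) : u ⊑ σ(s)}`" of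
`sum_kernelProb_truncRun_prefix_eq_blockMag`. [cite: AaronsonAmbainis2014, Thm. 23 (proof, p. 14)] -/
theorem targetTest_layoutC_encBlock (u q : List Bool) :
    targetTest F (layoutC F (encBlock F x ρ u)) q =
      decide (q ∈ {q' : List Bool | ∃ s ∈ univ.filter (fun s : Fin (numOracleBits F x) => u <+: bitString F x s), bitString F x s = q'}) := by
  have ht : tagOfC F (layoutC F (encBlock F x ρ u)) = false :: false :: u := tagOfC_layoutC F x _ _
  have hn : nP F (layoutC F (encBlock F x ρ u)).length = x.length := nP_layoutC F x _
  rw [targetTest, ht, hn]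
  simp only [List.getD_cons_succ, List.getD_cons_zero, Bool.false_eq_true, ↓reduceIte, List.drop_succ_cons,
    List.drop_zero, Finset.mem_filter, Finset.mem_univ, true_and, Set.mem_setOf_eq]
  rw [Bool.eq_iff_iff]
  simp only [Bool.and_eq_true, decide_eq_true_eq]
  constructor
  · rintro ⟨hu, hq⟩
    exact ⟨bitEquiv F x ⟨q, mem_shortStrings.2 hq⟩, by rw [bitString_bitEquiv' F x hq]; exact hu, bitString_bitEquiv' F x hq⟩
  · rintro ⟨s', hu, rfl⟩
    exact ⟨hu, mem_shortStrings.1 ((bitEquiv F x).symm s').2⟩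

/-- MEAN layouts: `nodeM = 1`; SINGLE / BLOCK layouts: `nodeM = T(|x|)`. [cite: AaronsonAmbainis2014, Thm. 23 (proof, p. 14)] -/
theorem nodeM_layoutC (w : List Bool) :
    nodeM F (layoutC F (boolPair x w)) = if isMeanC F (layoutC F (boolPair x w)) then 1 else (F.circ x.length).oracleQueries := by
  rw [nodeM, nP_layoutC]

/-! ### The statistic is computed on codes -/

variable {F}

/-- A private `take` by a binary count on raw lists (through the unary minimum with the length). [cite: AroraBarak2009, §1.3] -/
private theorem rawTakeNat' : CodeFP (pairE natE (rawE natE)) (rawE natE) (fun p : ℕ × List ℕ => p.2.take p.1) := by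
  have hu : CodeFP (pairE natE (rawE natE)) unE (fun p : ℕ × List ℕ => min p.1 p.2.length) :=
    unOfNatMin.comp (((ulength natE).comp (snd _ _)).pair (fst _ _))
  refine ((rawTakeUn natE).comp (hu.pair (snd _ _))).congr fun p => ?_
  obtain ⟨k, l⟩ := p
  show l.take (min k l.length) = l.take k
  rcases le_total k l.length with h | h
  · rw [min_eq_left h]
  · rw [min_eq_right h, List.take_length, List.take_of_length_le h]

/-- The clipped input length is computed on codes from `z`, for uniform `F`. [cite: AroraBarak2009, §6.2 Remark 6.7] -/
theorem codeFP_nP (hF : F.IsUniform) : CodeFP strE unE (fun z => nP F z.length) :=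
  (KeyedBlocks.codeFP_truncNOf F nOfLayout (codeFP_oracleQueries_un F hF) codeFP_nOfLayout).comp strLength

/-- **`targetTest` is computed on codes** (`(z, q) ↦ targetTest F z q`). [cite: AroraBarak2009, §1.3] -/
theorem targetTestC (hF : F.IsUniform) : CodeFP (pairE strE strE) bitE (fun p => targetTest F p.1 p.2) := by
  have hinj : Function.Injective strE := fun _ _ h => h
  have cZ : CodeFP (pairE strE strE) strE (fun p => p.1) := fst _ _
  have cQ : CodeFP (pairE strE strE) strE (fun p => p.2) := snd _ _
  have cTag : CodeFP (pairE strE strE) strE (fun p => tagOfC F p.1) := (tagOfCC hF).comp cZ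
  have c1 : CodeFP (pairE strE strE) bitE (fun p => (tagOfC F p.1).getD 1 false) := strGetD.comp ((const _ 1).pair cTag)
  have cσ : CodeFP (pairE strE strE) strE (fun p => (tagOfC F p.1).drop 2) := strDrop.comp ((const _ 2).pair cTag)
  have cEq : CodeFP (pairE strE strE) bitE (fun p => decide (p.2 = (tagOfC F p.1).drop 2)) :=
    (CodeFP.eq hinj).comp (cQ.pair cσ)
  have cPre : CodeFP (pairE strE strE) bitE (fun p => decide ((tagOfC F p.1).drop 2 <+: p.2)) :=
    ((CodeFP.eq hinj).comp (cσ.pair (strTake.comp ((strLength.comp cσ).pair cQ)))).congr fun p => by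
      simp only [List.prefix_iff_eq_take]
  have cW : CodeFP (pairE strE strE) natE (fun p => nP F p.1.length + F.ancillas (nP F p.1.length)) :=
    natOfUn.comp (unAdd.comp (((codeFP_nP hF).comp cZ).pair (((codeFP_rawDesc hF).comp ((codeFP_nP hF).comp cZ)).snd'.fst')))
  have cLen : CodeFP (pairE strE strE) bitE
      (fun p => decide (p.2.length < nP F p.1.length + F.ancillas (nP F p.1.length))) :=
    natLt.comp ((strNatLength.comp cQ).pair cW)
  exact (c1.ite cEq (cPre.and cLen)).congr fun p => by simp only [targetTest]

/-- The code of the block context `((z, s), b)`. [cite: AroraBarak2009, §1.3] -/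
abbrev qctxE : (List Bool × List Bool) × ℕ → List Bool := pairE (pairE strE strE) natE

/-- **`queryStr` is computed on codes** (`((z, s), b) ↦ queryStr F z s b`). [cite: AroraBarak2009, §1.3, §6.2] -/
theorem queryStrC (hF : F.IsUniform) : CodeFP qctxE strE (fun p => queryStr F p.1.1 p.1.2 p.2) := by
  have cZ : CodeFP qctxE strE (fun p => p.1.1) := (fst _ _).fst'
  have cS : CodeFP qctxE strE (fun p => p.1.2) := (fst _ _).snd'
  have cB : CodeFP qctxE natE (fun p => p.2) := snd _ _
  have cN : CodeFP qctxE unE (fun p => nP F p.1.1.length) := (codeFP_nP hF).comp cZ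
  have cD : CodeFP qctxE RawDesc.E (fun p => F.rawDesc (nP F p.1.1.length)) := (codeFP_rawDesc hF).comp cN
  have cM : CodeFP qctxE unE (fun p => F.ancillas (nP F p.1.1.length)) := cD.snd'.fst'
  have cRG : CodeFP qctxE (rawE RawGate.E) (fun p => (F.rawDesc (nP F p.1.1.length)).2.2) := cD.snd'.snd'
  -- the `b`-th raw oracle gate and its query wires
  have hfil := filter (σ := Unit) (eσ := unitE) (eα := RawGate.E) (p := fun t : Unit × RawGate => t.2.1)
    (RawGate.codeFP_tag.comp (snd _ _))
  have cγ : CodeFP qctxE RawGate.E (fun p => oracleRawAt (F.rawDesc (nP F p.1.1.length)).2.2 p.2) :=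
    ((rawGetOr RawGate.E).comp ((hfil.comp ((const _ ()).pair cRG)).pair (cB.pair (const _ ((false, 0, []) : RawGate))))).congr
      fun p => rfl
  have cBody := RawGate.codeFP_body.comp cγ
  have cWsK : CodeFP qctxE (rawE natE) (fun p => ((oracleRawAt (F.rawDesc (nP F p.1.1.length)).2.2 p.2).2.2).take
      (oracleRawAt (F.rawDesc (nP F p.1.1.length)).2.2 p.2).2.1) :=
    rawTakeNat'.comp (cBody.fst'.pair ((rawOfList natE).comp cBody.snd'))
  -- reading the moved wires in `s`: context `((n, L, m, b), s)`, item the wire index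
  have cNb : CodeFP qctxE natE (fun p => nP F p.1.1.length) := (natOfUn.comp cN).congr fun _ => id_eq _
  have cLb : CodeFP qctxE natE (fun p => p.1.1.length) := (natOfUn.comp (strLength.comp cZ)).congr fun _ => id_eq _
  have cMb : CodeFP qctxE natE (fun p => F.ancillas (nP F p.1.1.length)) := (natOfUn.comp cM).congr fun _ => id_eq _
  have cCtx : CodeFP qctxE (pairE KeyedBlocks.bctxE strE)
      (fun p => ((nP F p.1.1.length, p.1.1.length, F.ancillas (nP F p.1.1.length), p.2), p.1.2)) :=
    (cNb.pair (cLb.pair (cMb.pair cB))).pair cS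
  have cBit : CodeFP (pairE (pairE KeyedBlocks.bctxE strE) natE) bitE
      (fun t : ((ℕ × ℕ × ℕ × ℕ) × List Bool) × ℕ => t.1.2.getD (KeyedBlocks.embB t.1.1.1 t.1.1.2.1 t.1.1.2.2.1 t.1.1.2.2.2 t.2) false) :=
    strGetDNat.comp ((fst _ _).snd'.pair (KeyedBlocks.codeFP_embB.comp ((fst _ _).fst'.pair (snd _ _))))
  exact (bitsToStr.comp ((map cBit).comp (cCtx.pair cWsK))).congr fun p => by simp only [queryStr]

/-- The answer-wire test `0 < n + anc(n)` is computed on codes. [cite: AroraBarak2009, §1.3] -/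
private theorem widthPosC (hF : F.IsUniform) :
    CodeFP (pairE strE strE) bitE (fun p => decide (0 < nP F p.1.length + F.ancillas (nP F p.1.length))) := by
  have cN : CodeFP (pairE strE strE) unE (fun p => nP F p.1.length) := (codeFP_nP hF).comp (fst _ _)
  have cM : CodeFP (pairE strE strE) unE (fun p => F.ancillas (nP F p.1.length)) := ((codeFP_rawDesc hF).comp cN).snd'.fst'
  exact natLt.comp ((const _ 0).pair (natOfUn.comp (unAdd.comp (cN.pair cM))))

/-- The binary context `(n, |z|, anc(n), T(n))` of an instance is computed on codes. [cite: AroraBarak2009, §1.3] -/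
private theorem meanCtxC (hF : F.IsUniform) :
    CodeFP (pairE strE strE) KeyedBlocks.bctxE (fun p => (nP F p.1.length, p.1.length,
      F.ancillas (nP F p.1.length), (F.circ (nP F p.1.length)).oracleQueries)) := by
  have cZ : CodeFP (pairE strE strE) strE (fun p => p.1) := fst _ _
  have cN : CodeFP (pairE strE strE) unE (fun p => nP F p.1.length) := (codeFP_nP hF).comp cZ
  have cM : CodeFP (pairE strE strE) unE (fun p => F.ancillas (nP F p.1.length)) := ((codeFP_rawDesc hF).comp cN).snd'.fst'
  have cT : CodeFP (pairE strE strE) unE (fun p => (F.circ (nP F p.1.length)).oracleQueries) :=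
    (codeFP_oracleQueries_un F hF).comp cN
  have cNb : CodeFP (pairE strE strE) natE (fun p => nP F p.1.length) := (natOfUn.comp cN).congr fun _ => id_eq _
  have cLb : CodeFP (pairE strE strE) natE (fun p => p.1.length) := (natOfUn.comp (strLength.comp cZ)).congr fun _ => id_eq _
  have cMb : CodeFP (pairE strE strE) natE (fun p => F.ancillas (nP F p.1.length)) := (natOfUn.comp cM).congr fun _ => id_eq _
  have cTb : CodeFP (pairE strE strE) natE (fun p => (F.circ (nP F p.1.length)).oracleQueries) :=
    (natOfUn.comp cT).congr fun _ => id_eq _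
  exact cNb.pair (cLb.pair (cMb.pair cTb))

/-- The position of the answer wire of the full block is computed on codes. [cite: AroraBarak2009, §1.3] -/
private theorem meanWireC (hF : F.IsUniform) :
    CodeFP (pairE strE strE) natE (fun p => KeyedBlocks.embB (nP F p.1.length) p.1.length
      (F.ancillas (nP F p.1.length)) (F.circ (nP F p.1.length)).oracleQueries 0) :=
  (KeyedBlocks.codeFP_embB.comp ((meanCtxC hF).pair (const _ 0))).congr fun _ => rfl

/-- **`meanBit` is computed on codes.** [cite: AroraBarak2009, §1.3] -/
theorem meanBitC (hF : F.IsUniform) : CodeFP (pairE strE strE) bitE (fun p => meanBit F p.1 p.2) :=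
  ((widthPosC hF).and (strGetDNat.comp ((snd _ _).pair (meanWireC hF)))).congr fun p => by simp only [meanBit]

/-- The list of block bits is computed on codes. [cite: AroraBarak2009, §1.3] -/
private theorem blockBitsC (hF : F.IsUniform) :
    CodeFP (pairE strE strE) strE
      (fun p => (List.range (F.circ (nP F p.1.length)).oracleQueries).map fun b => targetTest F p.1 (queryStr F p.1 p.2 b)) := by
  have cT : CodeFP (pairE strE strE) unE (fun p => (F.circ (nP F p.1.length)).oracleQueries) :=
    (codeFP_oracleQueries_un F hF).comp ((codeFP_nP hF).comp (fst _ _))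
  have cBit : CodeFP qctxE bitE (fun p => targetTest F p.1.1 (queryStr F p.1.1 p.1.2 p.2)) :=
    (targetTestC hF).comp (((fst _ _).fst').pair (queryStrC hF))
  have cPair : CodeFP (pairE strE strE) (pairE (pairE strE strE) (rawE natE))
      (fun p => (p, List.range (F.circ (nP F p.1.length)).oracleQueries)) :=
    ((CodeFP.id _).pair (urange.comp cT)).congr fun _ => congrArg₂ Prod.mk (id_eq _) rfl
  have cBits : CodeFP (pairE strE strE) (rawE bitE)
      (fun p => (List.range (F.circ (nP F p.1.length)).oracleQueries).map fun b => targetTest F p.1 (queryStr F p.1 p.2 b)) :=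
    ((map cBit).comp cPair).congr fun _ => rfl
  exact (bitsToStr.comp cBits).congr fun _ => rfl

/-- **The node-test statistic is computed on codes**, for uniform `F`: there is a polynomial-time string function reading
`⟨z, s⟩ ↦ nodeStat F z s`. [cite: AroraBarak2009, §1.3, §6.2 Remark 6.7] [cite: BennettBernsteinBrassardVazirani1997, Thm. 4.14] -/
theorem nodeStatC (hF : F.IsUniform) : CodeFP (pairE strE strE) strE (fun p => nodeStat F p.1 p.2) := by
  have cMean : CodeFP (pairE strE strE) strE (fun p => [meanBit F p.1 p.2]) := (meanBitC hF).recodeOut fun _ => rfl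
  exact (((isMeanCC hF).comp (fst _ _)).ite cMean (blockBitsC hF)).congr fun p => by simp only [nodeStat]

/-- **`nodeStat ∈ FP` as a string function of `⟨z, s⟩`.** [cite: AroraBarak2009, §1.3] -/
theorem exists_nodeStat_FP (hF : F.IsUniform) :
    ∃ statU : List Bool → List Bool, statU ∈ FP ∧ ∀ z s, statU (boolPair z s) = nodeStat F z s := by
  obtain ⟨f, hf, hfe⟩ := nodeStatC hF
  exact ⟨f, hf, fun z s => hfe (z, s)⟩

end SimTreePB

end Summit.QuantumAdvantage.QuantumAdvantage.Cruxes.TransferPB.Birth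

end
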